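import Literature.NumberTheory.EllipticCurves.KolyvaginShaStructureAnyLevel
import HarnessLib

/-!
# Route `GenusKolyvaginAtTwo`, crux `ExactDescentAtTwo` (stmt-BirchSwinnertonDyer-22138): the
# finiteness clause of `BSD(E, 2)` on the exact locus — PROVED

Helper for the registered skeleton of crux #4 `ExactDescentAtTwo` (line `birth`, seat
`bsd-line-gk2-p3`; composition `ExactDescentAtTwo_of` = rank stub ∧ THIS ∧ `2`-adic valuation stub).
Of the three clauses of Miller's `BSDp W 2` the middle one — `Ш(E/ℚ)[2^∞]` finite — is free on the
route's exact locus: the exactness hypothesis `#Ш(E_K/K)[2^∞] = 2^{2M₀}` (the conclusion of crux #3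
`KolyvaginExactAtTwo`) makes `Ш(E_K/K)[2^∞]` finite (a `Nat.card` equal to a power of `2` is non-zero),
and finiteness of a `p`-primary part of `Ш` descends along a quadratic base change by the tree's
PROVED corank bookkeeping (`finite_primaryComponent_sha_of_finite_baseChange_quadratic`: Greenberg's
`corank Sel_{p^∞} = rank + corank Ш[p^∞]` over `K`, `ℚ` and for the twist, T. Dokchitser's additivity
of the Selmer corank and of the rank under quadratic base change), at ANY prime — here `p = 2`, where
the tree's odd-`p` order dictionary (`card_primaryComponent_sha_baseChange_quadratic_of_odd_of_finite`)
is not available but is not needed for finiteness. Both members `E` and any `ℚ`-model of `E^{(d_K)}`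
are covered. No named fact enters; axioms are the standard three. BSD is not proved by any of this.

References: [Dokchitser2013ParityNotes] §4; [Greenberg1999LNM] §1 pp. 54–57; [Miller2011LMS] Def. 1.1.
-/

-- D-0017: single-problem summit, so `Summit.BirchSwinnertonDyer.BirchSwinnertonDyer.…` repeats a
-- namespace BY DESIGN.
set_option linter.dupNamespace false

noncomputable section

namespace Summit.BirchSwinnertonDyer.BirchSwinnertonDyer.Theorems

open Literature.NumberTheory.EllipticCurves

/-- **`Ш(E/ℚ)[2^∞]` and `Ш(E^{(d_K)}/ℚ)[2^∞]` are finite on the exact locus.** For `E/ℚ` elliptic,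
`K` a quadratic field (`[K : ℚ] = 2`) and `M₀ : ℕ` with `#Ш(E_K/K)[2^∞] = 2^{2M₀}`: `Ш(E/ℚ)[2^∞]` is
finite, and so is `Ш(Wd/ℚ)[2^∞]` for every `ℚ`-model `Wd` of the twist `E^{(d_K)}`. (A power of `2`
is a non-zero `Nat.card`, so `Ш(E_K/K)[2^∞]` is finite; then
`finite_primaryComponent_sha_of_finite_baseChange_quadratic` at `p = 2`.)
[cite: Dokchitser2013ParityNotes, §4] [cite: Greenberg1999LNM, §1 pp. 54–57] -/
theorem genusKolyvagin_finite_sha_two_of_card_baseChange (W : WeierstrassCurve ℚ) [W.IsElliptic]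
    (K : Type) [Field K] [NumberField K] (h2 : Module.finrank ℚ K = 2) {M₀ : ℕ}
    (hcard : Nat.card (AddCommGroup.primaryComponent (W.baseChange K).sha 2) = 2 ^ (2 * M₀)) :
    Finite (AddCommGroup.primaryComponent W.sha 2) ∧
      ∀ (Wd : WeierstrassCurve ℚ) [Wd.IsElliptic],
        (∃ C : WeierstrassCurve.VariableChange ℚ, C • W.quadraticTwist (NumberField.discr K : ℚ) = Wd) →
          Finite (AddCommGroup.primaryComponent Wd.sha 2) := by
  haveI : Finite (AddCommGroup.primaryComponent (W.baseChange K).sha 2) :=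
    Nat.finite_of_card_ne_zero (by rw [hcard]; positivity)
  exact finite_primaryComponent_sha_of_finite_baseChange_quadratic W K h2 2

/-- **Registered stub `stub_finiteShaAtTwo` of crux `ExactDescentAtTwo` (stmt-BirchSwinnertonDyer-22138,
line `birth`) — the finiteness clause of `BSD(E, 2)` in the binders of the crux:** for `W/ℚ`
elliptic, `K` imaginary quadratic and `#Ш(E_K/K)[2^∞] = 2^{2M₀}`, `Ш(E/ℚ)[2^∞]` is finite — the form
consumed by the skeleton's composition `ExactDescentAtTwo_of`.
[cite: Miller2011LMS, Def. 1.1 (arXiv:1010.2431 p. 3)] [cite: Dokchitser2013ParityNotes, §4] -/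
theorem stub_finiteShaAtTwo : ∀ (W : WeierstrassCurve ℚ) [W.IsElliptic] (K : Type) [Field K] [NumberField K], IsImaginaryQuadratic K → ∀ (M₀ : ℕ), Nat.card (AddCommGroup.primaryComponent (W.baseChange K).sha 2) = 2 ^ (2 * M₀) → Finite (AddCommGroup.primaryComponent W.sha 2) :=
  fun W _ K _ _ hK _ hcard => (genusKolyvagin_finite_sha_two_of_card_baseChange W K hK.1 hcard).1

end Summit.BirchSwinnertonDyer.BirchSwinnertonDyer.Theorems

end
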